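import Mathlib
import HarnessLib
import Literature.Probability.Percolation.Percolation
import Literature.Probability.Percolation.PercolationProofs
import Literature.Probability.Percolation.TwoPointFunction
import Summits.CriticalPhenomena.PercolationContinuityZ3.Theses.PercTreeValue
import Summits.CriticalPhenomena.PercolationContinuityZ3.Theorems.PercTreeValueTetrahedronLogConvexityCertDefs
import Summits.CriticalPhenomena.PercolationContinuityZ3.Theorems.PercTreeValueTetrahedronLogConvexityReflection
import Summits.CriticalPhenomena.PercolationContinuityZ3.Theorems.PercTreeValueTetrahedronLogConvexityStopping
import Summits.CriticalPhenomena.PercolationContinuityZ3.Theorems.PercTreeValueTetrahedronLogConvexityStrongMarkov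
import Summits.CriticalPhenomena.PercolationContinuityZ3.Theorems.PercTreeValueTetrahedronLogConvexityContR

/-!
# `TetrahedronLogConvexity` (stmt-CriticalPhenomena-7801), line `Sketch` — the TRANSFER theorem, landed in hypothesis form

The composition of the registered skeleton `Cruxes/TetrahedronLogConvexity/Lines/Sketch.lean` with its one open
(crux-level) stub turned into an explicit hypothesis, so that the reduction itself is a tree theorem:

* `tetrahedronLogConvexity_of_certificate` — (V) vigour ∧ (L) lopsidedness of the mirror-symmetric two-seed
  certificate, with `η < 2v`, imply the crux `PercTreeValue.TetrahedronLogConvexity` with `1 + δ = 2(1+v)/(2+η)`: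
  strong Markov (`stub_strongMarkov`) identifies `Qb r R` with `P(A_R, 0 ↔ b_r)` and bounds `Qbc r R` by the
  four-point function (Harris on the continuation), the truncation is removed by `stub_contR` (`R → ∞`), and the
  mirror symmetry `stub_reflection` turns `P(0a,0b)²` into `P(0a,0b)·P(0a,0c)`;
* `tetrahedronLogConvexity_of_certHarrisGap` — the single-constant form: a uniform HARRIS GAP on the certificate's
  continuation, `κ·Qb² ≤ τ(0,a_r)·Qbc` eventually with `κ > 1`, implies the crux with `1 + δ = κ`
  (`κ = E_A[m₊m₋]/E_A[m₊]²` in the notation of the idea card `mirror-certificate-vigour`; (V)∧(L) give `κ = 2(1+v)/(2+η)`).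

Nothing here is conditional on an unproved named fact; the hypotheses are the crux-level statements themselves.
-/

noncomputable section

open MeasureTheory Filter
open Literature.Probability.Percolation Literature.Probability.LatticeModels

namespace Summit.CriticalPhenomena.PercolationContinuityZ3.Theorems.TetrahedronLogConvexity.Cert

/-- **Single-constant transfer.** A uniform Harris gap `κ > 1` on the continuation of the two-seed certificate,
`κ · Qb(r,R)² ≤ τ(0,a_r) · Qbc(r,R)` for all large `r` and then all large `R`, implies
`TetrahedronLogConvexity` with `1 + δ = κ`. [folklore] -/
theorem tetrahedronLogConvexity_of_certHarrisGap :
    (∃ κ : ℝ, 1 < κ ∧ ∃ r₀ : ℕ, ∀ r : ℕ, r₀ ≤ r → ∃ R₀ : ℕ, ∀ R : ℕ, R₀ ≤ R →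
      κ * Qb r R ^ 2 ≤ tau 3 (criticalProbI 3) 0 (vA r) * Qbc r R) →
    Summit.CriticalPhenomena.PercolationContinuityZ3.Theses.PercTreeValue.TetrahedronLogConvexity := by
  intro hgap
  unfold Summit.CriticalPhenomena.PercolationContinuityZ3.Theses.PercTreeValue.TetrahedronLogConvexity
  obtain ⟨κ, hκ1, r₀, hgap⟩ := hgap
  refine ⟨κ - 1, by linarith, r₀, fun r hr => ?_⟩
  obtain ⟨R₀, hR⟩ := hgap r hr
  set t3 := Pc.real (openConn 0 (vA r) ∩ openConn 0 (vB r)) with ht3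
  set t4 := Pc.real (openConn 0 (vA r) ∩ openConn 0 (vB r) ∩ openConn 0 (vC r)) with ht4
  set τ := tau 3 (criticalProbI 3) 0 (vA r) with hτ
  have h0τ : 0 ≤ τ := tau_nonneg _ _ _
  have hfin : ∀ R : ℕ, R₀ ≤ R → κ * Pc.real (AR r R ∩ openConn 0 (vB r)) ^ 2 ≤ τ * t4 := by
    intro R hRR
    have hV := hR R hRR
    obtain ⟨hmarg, hharris⟩ := stub_strongMarkov r R (stub_stopping r R)
    have hQb : Qb r R = Pc.real (AR r R ∩ openConn 0 (vB r)) :=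
      hmarg (openConn 0 (vB r)) (measurableSet_openConn_holds 0 (vB r))
    have hsub : AR r R ∩ openConn 0 (vB r) ∩ openConn 0 (vC r) ⊆
        openConn 0 (vA r) ∩ openConn 0 (vB r) ∩ openConn 0 (vC r) := by
      intro ω hω
      exact ⟨⟨(stub_contR r).1 R hω.1.1, hω.1.2⟩, hω.2⟩
    have hQbc : Qbc r R ≤ t4 := hharris.trans (measureReal_mono hsub)
    rw [← hQb]
    exact hV.trans (mul_le_mul_of_nonneg_left hQbc h0τ)
  have hlim : Tendsto (fun R : ℕ => κ * Pc.real (AR r R ∩ openConn 0 (vB r)) ^ 2) atTop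
      (nhds (κ * t3 ^ 2)) := ((stub_contR r).2.pow 2).const_mul κ
  have hle : κ * t3 ^ 2 ≤ τ * t4 :=
    le_of_tendsto hlim (Filter.eventually_atTop.2 ⟨R₀, hfin⟩)
  have hsym : Pc.real (openConn 0 ![(r : ℤ), (r : ℤ), 0] ∩ openConn 0 ![0, (r : ℤ), (r : ℤ)]) = t3 :=
    stub_reflection r
  have ht3' : Pc.real (openConn 0 ![(r : ℤ), (r : ℤ), 0] ∩ openConn 0 ![(r : ℤ), 0, (r : ℤ)]) = t3 := rfl
  have ht4' : Pc.real (openConn 0 ![(r : ℤ), (r : ℤ), 0] ∩ openConn 0 ![(r : ℤ), 0, (r : ℤ)] ∩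
      openConn 0 ![0, (r : ℤ), (r : ℤ)]) = t4 := rfl
  have hτ' : tau 3 (criticalProbI 3) 0 ![(r : ℤ), (r : ℤ), 0] = τ := rfl
  change (1 + (κ - 1)) * Pc.real (openConn 0 ![(r : ℤ), (r : ℤ), 0] ∩ openConn 0 ![(r : ℤ), 0, (r : ℤ)]) *
      Pc.real (openConn 0 ![(r : ℤ), (r : ℤ), 0] ∩ openConn 0 ![0, (r : ℤ), (r : ℤ)]) ≤
    Pc.real (openConn 0 ![(r : ℤ), (r : ℤ), 0] ∩ openConn 0 ![(r : ℤ), 0, (r : ℤ)] ∩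
      openConn 0 ![0, (r : ℤ), (r : ℤ)]) * tau 3 (criticalProbI 3) 0 ![(r : ℤ), (r : ℤ), 0]
  rw [hsym, ht3', ht4', hτ']
  calc (1 + (κ - 1)) * t3 * t3 = κ * t3 ^ 2 := by ring
    _ ≤ τ * t4 := hle
    _ = t4 * τ := by ring

/-- **Transfer for the line's registered crux-level stub.** Vigour (V) and lopsidedness (L) of the two-seed
certificate with `η < 2v` imply `TetrahedronLogConvexity` (with `1 + δ = 2(1+v)/(2+η)`): from (V) and (L),
`2(1+v)·Qb² ≤ τ·(Qbc + Qbb) ≤ (2+η)·τ·Qbc`, which is the Harris-gap hypothesis with `κ = 2(1+v)/(2+η) > 1`. [folklore] -/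
theorem tetrahedronLogConvexity_of_certificate :
    (∃ v η : ℝ, 0 ≤ η ∧ η < 2 * v ∧ ∃ r₀ : ℕ, ∀ r : ℕ, r₀ ≤ r → ∃ R₀ : ℕ, ∀ R : ℕ, R₀ ≤ R →
      2 * (1 + v) * Qb r R ^ 2 ≤ tau 3 (criticalProbI 3) 0 (vA r) * (Qbc r R + Qbb r R) ∧
      Qbb r R ≤ (1 + η) * Qbc r R) →
    Summit.CriticalPhenomena.PercolationContinuityZ3.Theses.PercTreeValue.TetrahedronLogConvexity := by
  intro hcert
  obtain ⟨v, η, _hη, hηv, r₀, hcert⟩ := hcert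
  have h2η : 0 < 2 + η := by linarith
  refine tetrahedronLogConvexity_of_certHarrisGap ⟨2 * (1 + v) / (2 + η), ?_, r₀, fun r hr => ?_⟩
  · rw [lt_div_iff₀ h2η]; linarith
  · obtain ⟨R₀, hR⟩ := hcert r hr
    refine ⟨R₀, fun R hRR => ?_⟩
    obtain ⟨hV, hL⟩ := hR R hRR
    have h0τ : 0 ≤ tau 3 (criticalProbI 3) 0 (vA r) := tau_nonneg _ _ _
    have hVL : 2 * (1 + v) * Qb r R ^ 2 ≤ (2 + η) * (tau 3 (criticalProbI 3) 0 (vA r) * Qbc r R) := by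
      calc 2 * (1 + v) * Qb r R ^ 2 ≤ tau 3 (criticalProbI 3) 0 (vA r) * (Qbc r R + Qbb r R) := hV
        _ ≤ tau 3 (criticalProbI 3) 0 (vA r) * (Qbc r R + (1 + η) * Qbc r R) := by gcongr
        _ = (2 + η) * (tau 3 (criticalProbI 3) 0 (vA r) * Qbc r R) := by ring
    rw [div_mul_eq_mul_div, div_le_iff₀ h2η]
    linarith

end Summit.CriticalPhenomena.PercolationContinuityZ3.Theorems.TetrahedronLogConvexity.Cert
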